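import Summits.QuantumFields.YangMills.Theorems.BalabanUVNodesN22KnitBodyTower

/-!
# BalabanUVNodes ∕ N22 knit, THE SECOND-ORDER BODY TOWER IN TWO LETTER CURRENCIES — `BalabanUVNodesN22KnitBodyTower`'s tower
# `abs_secondDiff_action_le_linear_of_shapes` instanced (i) with EXPONENT-level letters (`𝐏^{(k)}`, the old action along the bracket's
# coupling curve, the remainder: module 9's currency) and (ii) with NEW-TERM-level letters (the currency the Gaussian body of
# `B12Eq213GaussianLastCoupling` ∕ `B12Eq213GaussianSecondOrder` supplies) — LINEAR growth in the age either way (Track A, DAG node N22 = NE9;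
# cluster K4 «SpineRates»; seat `pub-ymgap-dag-n22-a`)

HONEST FRAMING.  Count-neutral kernel bookkeeping about the TYPED (2.13) body under DISPLAYED hypotheses; NOT a node discharge; NE5 ∕ NE9
NOT IN PRINT, NOT PROVED; un-localised (the `e^{−κd_j(X)}` weights are the object W1); one finite four-torus programme at fixed ε; nothing
continuum ∕ ℝ⁴ ∕ OS ∕ mass-gap ∕ Clay.  0 `sorry`, 0 `def`, standard axioms.  `--supports` item `SpineGivenEndpoint` (route «BalabanUVNodes»).

WHAT.
* §1 `abs_step_secondDiff_last` — ONE STEP, SECOND ORDER, LAST COUPLING with exponent-level letters: one old action `𝐄_k` in the bracket,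
  three couplings `t − d, t, t + d` of the SAME datum `{D k with Q := 𝐄_k ∘ τ k}`; with `L_P`, `M_P` (first ∕ second differences of
  `𝐏^{(k)}` in `g_k` on the support), `L_τ`, `M_τ` (the old action ALONG THE COUPLING CURVE `a ↦ 𝐄_k(τ k a U B)`), `M_R` (the remainder):
  `≤ (M_P + M_τ + M_R + 2(L_P + L_τ)²)·d²` (module 11's (S2-last) `abs_secondDiff_newTerm_coupling_le` on the exponent `𝐏^{(k)} + 𝐄_k∘τ`).
* §2 `abs_secondDiff_action_le_linear` — the tower with EXPONENT-LEVEL letters: (L1) from module 9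
  (`abs_action_sub_action_le_tower_unsubtracted`, `L₁ = L_P + L_τ + L_R`), (B2) from §1 (`ℓ₂ = M_P + M_τ + M_R + 2(L_P + L_τ)²`):
  `|Δ²_{g_i} 𝐄_k(·; U)| ≤ (ℓ₂ + 2L₁²·(k − 1 − i))·d²`; `abs_secondDiff_newTerm_le_linear` for the subtracted new term.
* §3 `abs_secondDiff_action_le_linear_of_lip` — the tower with NEW-TERM-LEVEL letters: per step the un-subtracted new term
  `a ↦ newTerm {D k with Q := 𝐄_k^h ∘ τ k} a U` is `L`-Lipschitz and has second differences `≤ λ₂d²` in the last coupling on the window, the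
  remainder `L_R` ∕ `M_R`: (L1) from `N22KnitBodyTower.abs_action_sub_action_le_tower_of_lip` (`L₁ = L + L_R`), (B2) `ℓ₂ = λ₂ + M_R`:
  `≤ (λ₂ + M_R + 2(L + L_R)²·(k − 1 − i))·d²`; `abs_secondDiff_newTerm_le_linear_of_lip` likewise.  For the Gaussian body the twin's
  `hasDerivAt_newTerm_gaussian_of_quadDom` (p410755) and `abs_secondDeriv_newTerm_gaussian_le` (module 12) are exactly `L` and `λ₂` by the
  mean value theorem, in the (2.20)-dominated currency.
THE LETTERS `L_τ`, `M_τ` (resp. `L`, `λ₂`) are DISPLAYED AND UNIFORM IN `k`: one constant for the ACCUMULATED old action `𝐄_k` along the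
bracket's coupling curve at every step — a hypothesis the un-localised body does NOT justify (it is W1's localisation + `e^{−κd}` again;
ref-B READ-207 A4: module 9's «constant moduli» and this file's «linear growth» are CONDITIONAL on that uniformity, carried here as the
binders `hEτ`∕`hEτ2` resp. `hN`∕`hN2`, not asserted).  First order = [Balaban1987RG1] (1.17) ∘ the substitution = the twin's
`B12Eq212BracketCoupling.abs_deriv_re_bracket_le` (`‖E′‖·‖C‖(1+‖B‖²)`, `‖E′‖` from a Cauchy estimate on `U^c_k`); second order = the same
Cauchy estimate one order up (not typed).  READING as in the parent file: linear growth ⟹ the (R₂) shape with growth `ν` for every `ν > 1`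
(`BalabanUVNodesN22KnitLinear`), so ROAD 2 spends only node N18's `θ < 1` once the tower is localized (W1).

References (TYPES only): [Balaban1987RG1] = T. Bałaban, Commun. Math. Phys. **109** (1987) 249–301 — (0.23) p. 256, (1.17)–(1.18) and the
C^∞ clause p. 263, (2.1) p. 265, (2.11)–(2.13) pp. 267–268, (2.20) p. 269, p. 298.
-/

noncomputable section

namespace Summit.QuantumFields.YangMills.BalabanUVNodes.N22KnitBodyTowerLetters

open MeasureTheory Set
open scoped BigOperators
open Literature.MathematicalPhysics.QuantumFieldTheory.Balaban1983to89
open Literature.MathematicalPhysics.QuantumFieldTheory.Balaban1983to89.B12Eq213Body268 (FluctData)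
open Literature.MathematicalPhysics.QuantumFieldTheory.Balaban1983to89.B12Eq213HistoryTowerSharp (abs_action_sub_action_le_tower_unsubtracted)
open Literature.MathematicalPhysics.QuantumFieldTheory.Balaban1983to89.B12Eq213SecondDifference (abs_secondDiff_newTerm_coupling_le)
open Summit.QuantumFields.YangMills.BalabanUVNodes.N22KnitBodyTower
  (abs_action_sub_action_le_tower_of_lip abs_secondDiff_action_le_linear_of_shapes abs_secondDiff_newTerm_le_linear_of_shapes)

section Body

variable {Y : Type*}

/-! ## §1 One step, second order, LAST coupling — exponent-level letters -/

/-- **ONE STEP, SECOND ORDER, LAST COUPLING.**  One old action `E_k : Y → ℝ` in the bracket, three couplings `t − d, t, t + d` of the SAME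
datum `{D with Q := 𝐄_k ∘ τ}`: with the first-order letters `L_P` (of `𝐏^{(k)}`), `L_τ` (of the old action ALONG THE COUPLING CURVE
`a ↦ 𝐄_k(τ a U B)`) between `t − d` and `t`, the second-order letters `M_P`, `M_τ` on the triple (all on the support of `χ_U`), and `M_R` for
the remainder: the three new total actions have second difference `≤ (M_P + M_τ + M_R + 2(L_P + L_τ)²)·d²` — module 11's (S2-last) on the
exponent `𝐏^{(k)}(a) + 𝐄_k(τ a U B)`, plus the remainder. [cite: Balaban1987RG1, (2.11)–(2.13) pp.267–268 and p.263 (C^∞ clause)] -/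
theorem abs_step_secondDiff_last (D : FluctData Y) (τ : ℝ → Y → D.𝓑 → Y) (R : ℝ → Y → ℝ) (Ek : Y → ℝ)
    {LP Lτ MP Mτ MR t d : ℝ} {U : Y}
    (him : Integrable (FluctData.integrand { D with Q := fun a U B => Ek (τ a U B) } (t - d) U) (D.μ U))
    (hi0 : Integrable (FluctData.integrand { D with Q := fun a U B => Ek (τ a U B) } t U) (D.μ U))
    (hip : Integrable (FluctData.integrand { D with Q := fun a U B => Ek (τ a U B) } (t + d) U) (D.μ U))
    (hpos : 0 < FluctData.integral { D with Q := fun a U B => Ek (τ a U B) } t U)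
    (hP1 : ∀ B, D.χ U B ≠ 0 → |D.P t U B - D.P (t - d) U B| ≤ LP * d)
    (hEτ1 : ∀ B, D.χ U B ≠ 0 → |Ek (τ t U B) - Ek (τ (t - d) U B)| ≤ Lτ * d)
    (hP2 : ∀ B, D.χ U B ≠ 0 → |D.P (t + d) U B - 2 * D.P t U B + D.P (t - d) U B| ≤ MP * d ^ 2)
    (hEτ2 : ∀ B, D.χ U B ≠ 0 → |Ek (τ (t + d) U B) - 2 * Ek (τ t U B) + Ek (τ (t - d) U B)| ≤ Mτ * d ^ 2)
    (hR2 : |R (t + d) U - 2 * R t U + R (t - d) U| ≤ MR * d ^ 2) :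
    |(FluctData.newTerm { D with Q := fun a U B => Ek (τ a U B) } (t + d) U + R (t + d) U)
      - 2 * (FluctData.newTerm { D with Q := fun a U B => Ek (τ a U B) } t U + R t U)
      + (FluctData.newTerm { D with Q := fun a U B => Ek (τ a U B) } (t - d) U + R (t - d) U)|
      ≤ (MP + Mτ + MR + 2 * (LP + Lτ) ^ 2) * d ^ 2 := by
  have h1 : ∀ B, D.χ U B ≠ 0 →
      |FluctData.exponent { D with Q := fun a U B => Ek (τ a U B) } t U B -
        FluctData.exponent { D with Q := fun a U B => Ek (τ a U B) } (t - d) U B| ≤ (LP + Lτ) * d := by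
    intro B hB
    show |(D.P t U B + Ek (τ t U B)) - (D.P (t - d) U B + Ek (τ (t - d) U B))| ≤ (LP + Lτ) * d
    rw [show (D.P t U B + Ek (τ t U B)) - (D.P (t - d) U B + Ek (τ (t - d) U B))
        = (D.P t U B - D.P (t - d) U B) + (Ek (τ t U B) - Ek (τ (t - d) U B)) by ring]
    calc |(D.P t U B - D.P (t - d) U B) + (Ek (τ t U B) - Ek (τ (t - d) U B))|
        ≤ |D.P t U B - D.P (t - d) U B| + |Ek (τ t U B) - Ek (τ (t - d) U B)| := abs_add_le _ _
      _ ≤ LP * d + Lτ * d := add_le_add (hP1 B hB) (hEτ1 B hB)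
      _ = (LP + Lτ) * d := by ring
  have h2 : ∀ B, D.χ U B ≠ 0 →
      |FluctData.exponent { D with Q := fun a U B => Ek (τ a U B) } (t + d) U B -
        2 * FluctData.exponent { D with Q := fun a U B => Ek (τ a U B) } t U B +
        FluctData.exponent { D with Q := fun a U B => Ek (τ a U B) } (t - d) U B| ≤ (MP + Mτ) * d ^ 2 := by
    intro B hB
    show |(D.P (t + d) U B + Ek (τ (t + d) U B)) - 2 * (D.P t U B + Ek (τ t U B)) + (D.P (t - d) U B + Ek (τ (t - d) U B))|
      ≤ (MP + Mτ) * d ^ 2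
    rw [show (D.P (t + d) U B + Ek (τ (t + d) U B)) - 2 * (D.P t U B + Ek (τ t U B)) + (D.P (t - d) U B + Ek (τ (t - d) U B))
        = (D.P (t + d) U B - 2 * D.P t U B + D.P (t - d) U B)
          + (Ek (τ (t + d) U B) - 2 * Ek (τ t U B) + Ek (τ (t - d) U B)) by ring]
    calc |(D.P (t + d) U B - 2 * D.P t U B + D.P (t - d) U B)
          + (Ek (τ (t + d) U B) - 2 * Ek (τ t U B) + Ek (τ (t - d) U B))|
        ≤ |D.P (t + d) U B - 2 * D.P t U B + D.P (t - d) U B|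
          + |Ek (τ (t + d) U B) - 2 * Ek (τ t U B) + Ek (τ (t - d) U B)| := abs_add_le _ _
      _ ≤ MP * d ^ 2 + Mτ * d ^ 2 := add_le_add (hP2 B hB) (hEτ2 B hB)
      _ = (MP + Mτ) * d ^ 2 := by ring
  have hN := abs_secondDiff_newTerm_coupling_le { D with Q := fun a U B => Ek (τ a U B) } him hi0 hip hpos h1 h2
  rw [show (FluctData.newTerm { D with Q := fun a U B => Ek (τ a U B) } (t + d) U + R (t + d) U)
      - 2 * (FluctData.newTerm { D with Q := fun a U B => Ek (τ a U B) } t U + R t U)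
      + (FluctData.newTerm { D with Q := fun a U B => Ek (τ a U B) } (t - d) U + R (t - d) U)
      = (FluctData.newTerm { D with Q := fun a U B => Ek (τ a U B) } (t + d) U
          - 2 * FluctData.newTerm { D with Q := fun a U B => Ek (τ a U B) } t U
          + FluctData.newTerm { D with Q := fun a U B => Ek (τ a U B) } (t - d) U)
        + (R (t + d) U - 2 * R t U + R (t - d) U) by ring]
  calc _ ≤ |FluctData.newTerm { D with Q := fun a U B => Ek (τ a U B) } (t + d) U
          - 2 * FluctData.newTerm { D with Q := fun a U B => Ek (τ a U B) } t U
          + FluctData.newTerm { D with Q := fun a U B => Ek (τ a U B) } (t - d) U|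
        + |R (t + d) U - 2 * R t U + R (t - d) U| := abs_add_le _ _
    _ ≤ ((MP + Mτ) * d ^ 2 + 2 * ((LP + Lτ) * d) ^ 2) + MR * d ^ 2 := add_le_add hN hR2
    _ = (MP + Mτ + MR + 2 * (LP + Lτ) ^ 2) * d ^ 2 := by ring

/-! ## §2 The tower with EXPONENT-level letters -/

/-- **THE SECOND-ORDER TOWER, EXPONENT-LEVEL LETTERS.**  Module 9's data and first-order letters `L_P` (`𝐏^{(k)}` in `g_k` on the support),
`L_τ` (the old action along the coupling curve), `L_R` (the remainder), plus the second-order letters `M_P`, `M_τ`, `M_R` on arithmetic triples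
of the window ⟹ for every history `g ∈ W^ℕ`, older coupling `i < k`, triple `t − d, t, t + d ∈ W` and `U ∈ Dom k`:
`|𝐄_k(g[i ↦ t+d]; U) − 2𝐄_k(g[i ↦ t]; U) + 𝐄_k(g[i ↦ t−d]; U)| ≤ (ℓ₂ + 2L₁²·(k − 1 − i))·d²`, `L₁ = L_P + L_τ + L_R`,
`ℓ₂ = M_P + M_τ + M_R + 2(L_P + L_τ)²`. [cite: Balaban1987RG1, §0 (0.23) p.256, (2.11)–(2.13) pp.267–268, p.263 and §5 p.298] -/
theorem abs_secondDiff_action_le_linear (D : ℕ → FluctData Y) (τ : (k : ℕ) → ℝ → Y → (D k).𝓑 → Y)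
    (R : ℕ → ℝ → Y → ℝ) (E : ℕ → (ℕ → ℝ) → Y → ℝ) (Dom : ℕ → Set Y) (W : Set ℝ) {LP Lτ LR MP Mτ MR : ℝ}
    (hE0 : ∀ h h' : ℕ → ℝ, ∀ U, E 0 h U = E 0 h' U)
    (hrec : ∀ (h : ℕ → ℝ) (k : ℕ) (U : Y), (∀ i, h i ∈ W) →
      E (k + 1) h U = FluctData.newTerm { D k with Q := fun a U B => E k h (τ k a U B) } (h k) U + R k (h k) U)
    (hτ : ∀ k U, U ∈ Dom (k + 1) → ∀ a ∈ W, ∀ B, (D k).χ U B ≠ 0 → τ k a U B ∈ Dom k)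
    (hint : ∀ (h : ℕ → ℝ) (k : ℕ), (∀ i, h i ∈ W) → ∀ U ∈ Dom (k + 1), ∀ a ∈ W,
      Integrable (FluctData.integrand { D k with Q := fun a U B => E k h (τ k a U B) } a U) ((D k).μ U))
    (hpos : ∀ (h : ℕ → ℝ) (k : ℕ), (∀ i, h i ∈ W) → ∀ U ∈ Dom (k + 1), ∀ a ∈ W,
      0 < FluctData.integral { D k with Q := fun a U B => E k h (τ k a U B) } a U)
    (hP : ∀ k, ∀ U ∈ Dom (k + 1), ∀ B, (D k).χ U B ≠ 0 → ∀ a ∈ W, ∀ a' ∈ W,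
      |(D k).P a' U B - (D k).P a U B| ≤ LP * |a' - a|)
    (hEτ : ∀ (h : ℕ → ℝ) (k : ℕ), (∀ i, h i ∈ W) → ∀ U ∈ Dom (k + 1), ∀ B, (D k).χ U B ≠ 0 → ∀ a ∈ W, ∀ a' ∈ W,
      |E k h (τ k a' U B) - E k h (τ k a U B)| ≤ Lτ * |a' - a|)
    (hR : ∀ k, ∀ U ∈ Dom (k + 1), ∀ a ∈ W, ∀ a' ∈ W, |R k a' U - R k a U| ≤ LR * |a' - a|)
    (hP2 : ∀ k, ∀ U ∈ Dom (k + 1), ∀ B, (D k).χ U B ≠ 0 → ∀ t d : ℝ, 0 < d → t - d ∈ W → t ∈ W → t + d ∈ W →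
      |(D k).P (t + d) U B - 2 * (D k).P t U B + (D k).P (t - d) U B| ≤ MP * d ^ 2)
    (hEτ2 : ∀ (h : ℕ → ℝ) (k : ℕ), (∀ i, h i ∈ W) → ∀ U ∈ Dom (k + 1), ∀ B, (D k).χ U B ≠ 0 →
      ∀ t d : ℝ, 0 < d → t - d ∈ W → t ∈ W → t + d ∈ W →
        |E k h (τ k (t + d) U B) - 2 * E k h (τ k t U B) + E k h (τ k (t - d) U B)| ≤ Mτ * d ^ 2)
    (hR2 : ∀ k, ∀ U ∈ Dom (k + 1), ∀ t d : ℝ, 0 < d → t - d ∈ W → t ∈ W → t + d ∈ W →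
      |R k (t + d) U - 2 * R k t U + R k (t - d) U| ≤ MR * d ^ 2) :
    ∀ g : ℕ → ℝ, (∀ j, g j ∈ W) → ∀ (i k : ℕ), i < k → ∀ t d : ℝ, 0 < d → t - d ∈ W → t ∈ W → t + d ∈ W →
      ∀ U ∈ Dom k,
        |E k (Function.update g i (t + d)) U - 2 * E k (Function.update g i t) U + E k (Function.update g i (t - d)) U|
          ≤ (MP + Mτ + MR + 2 * (LP + Lτ) ^ 2 + 2 * (LP + Lτ + LR) ^ 2 * ((k - 1 - i : ℕ) : ℝ)) * d ^ 2 :=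
  abs_secondDiff_action_le_linear_of_shapes D τ R E Dom W hE0 hrec hτ hint hpos
    (fun g g' hg hg' => abs_action_sub_action_le_tower_unsubtracted D τ R E Dom W g g' hg hg' (fun U => hE0 _ _ U) hrec hτ hint hpos
      hP hEτ hR)
    (fun h hh k U hU t d hd htm ht htp => by
      have had : |t - (t - d)| = d := by rw [show t - (t - d) = d by ring, abs_of_pos hd]
      exact abs_step_secondDiff_last (D k) (τ k) (R k) (E k h)
        (hint h k hh U hU _ htm) (hint h k hh U hU _ ht) (hint h k hh U hU _ htp) (hpos h k hh U hU _ ht)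
        (fun B hB => by simpa only [had] using hP k U hU B hB (t - d) htm t ht)
        (fun B hB => by simpa only [had] using hEτ h k hh U hU B hB (t - d) htm t ht)
        (fun B hB => hP2 k U hU B hB t d hd htm ht htp) (fun B hB => hEτ2 h k hh U hU B hB t d hd htm ht htp)
        (hR2 k U hU t d hd htm ht htp))

/-- **THE SUBTRACTED NEW TERM, EXPONENT-LEVEL LETTERS**: under §2's hypotheses, for `i < k`, a triple in the window, `U ∈ Dom (k+1)` and
`σ U ∈ Dom k`, Bałaban's subtracted new term of (2.13) has second difference in `g_i` at most `2·(ℓ₂ + 2L₁²·(k − i))·d²`.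
[cite: Balaban1987RG1, (2.12)–(2.13) p.268 and §0 (0.23) p.256] -/
theorem abs_secondDiff_newTerm_le_linear (D : ℕ → FluctData Y) (τ : (k : ℕ) → ℝ → Y → (D k).𝓑 → Y)
    (R : ℕ → ℝ → Y → ℝ) (E : ℕ → (ℕ → ℝ) → Y → ℝ) (Dom : ℕ → Set Y) (W : Set ℝ) {LP Lτ LR MP Mτ MR : ℝ}
    (hE0 : ∀ h h' : ℕ → ℝ, ∀ U, E 0 h U = E 0 h' U)
    (hrec : ∀ (h : ℕ → ℝ) (k : ℕ) (U : Y), (∀ i, h i ∈ W) →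
      E (k + 1) h U = FluctData.newTerm { D k with Q := fun a U B => E k h (τ k a U B) } (h k) U + R k (h k) U)
    (hτ : ∀ k U, U ∈ Dom (k + 1) → ∀ a ∈ W, ∀ B, (D k).χ U B ≠ 0 → τ k a U B ∈ Dom k)
    (hint : ∀ (h : ℕ → ℝ) (k : ℕ), (∀ i, h i ∈ W) → ∀ U ∈ Dom (k + 1), ∀ a ∈ W,
      Integrable (FluctData.integrand { D k with Q := fun a U B => E k h (τ k a U B) } a U) ((D k).μ U))
    (hpos : ∀ (h : ℕ → ℝ) (k : ℕ), (∀ i, h i ∈ W) → ∀ U ∈ Dom (k + 1), ∀ a ∈ W,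
      0 < FluctData.integral { D k with Q := fun a U B => E k h (τ k a U B) } a U)
    (hP : ∀ k, ∀ U ∈ Dom (k + 1), ∀ B, (D k).χ U B ≠ 0 → ∀ a ∈ W, ∀ a' ∈ W,
      |(D k).P a' U B - (D k).P a U B| ≤ LP * |a' - a|)
    (hEτ : ∀ (h : ℕ → ℝ) (k : ℕ), (∀ i, h i ∈ W) → ∀ U ∈ Dom (k + 1), ∀ B, (D k).χ U B ≠ 0 → ∀ a ∈ W, ∀ a' ∈ W,
      |E k h (τ k a' U B) - E k h (τ k a U B)| ≤ Lτ * |a' - a|)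
    (hR : ∀ k, ∀ U ∈ Dom (k + 1), ∀ a ∈ W, ∀ a' ∈ W, |R k a' U - R k a U| ≤ LR * |a' - a|)
    (hP2 : ∀ k, ∀ U ∈ Dom (k + 1), ∀ B, (D k).χ U B ≠ 0 → ∀ t d : ℝ, 0 < d → t - d ∈ W → t ∈ W → t + d ∈ W →
      |(D k).P (t + d) U B - 2 * (D k).P t U B + (D k).P (t - d) U B| ≤ MP * d ^ 2)
    (hEτ2 : ∀ (h : ℕ → ℝ) (k : ℕ), (∀ i, h i ∈ W) → ∀ U ∈ Dom (k + 1), ∀ B, (D k).χ U B ≠ 0 →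
      ∀ t d : ℝ, 0 < d → t - d ∈ W → t ∈ W → t + d ∈ W →
        |E k h (τ k (t + d) U B) - 2 * E k h (τ k t U B) + E k h (τ k (t - d) U B)| ≤ Mτ * d ^ 2)
    (hR2 : ∀ k, ∀ U ∈ Dom (k + 1), ∀ t d : ℝ, 0 < d → t - d ∈ W → t ∈ W → t + d ∈ W →
      |R k (t + d) U - 2 * R k t U + R k (t - d) U| ≤ MR * d ^ 2)
    (σ : Y → Y) {g : ℕ → ℝ} (hg : ∀ j, g j ∈ W) {i k : ℕ} (hik : i < k) {t d : ℝ} (hd : 0 < d)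
    (htm : t - d ∈ W) (ht : t ∈ W) (htp : t + d ∈ W) {U : Y} (hU : U ∈ Dom (k + 1)) (hσ : σ U ∈ Dom k) :
    |FluctData.newTerm
          { D k with Q := fun a U B => E k (Function.update g i (t + d)) (τ k a U B) - E k (Function.update g i (t + d)) (σ U) }
          (g k) U
      - 2 * FluctData.newTerm
          { D k with Q := fun a U B => E k (Function.update g i t) (τ k a U B) - E k (Function.update g i t) (σ U) } (g k) U
      + FluctData.newTerm
          { D k with Q := fun a U B => E k (Function.update g i (t - d)) (τ k a U B) - E k (Function.update g i (t - d)) (σ U) }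
          (g k) U|
      ≤ 2 * (MP + Mτ + MR + 2 * (LP + Lτ) ^ 2 + 2 * (LP + Lτ + LR) ^ 2 * ((k - i : ℕ) : ℝ)) * d ^ 2 :=
  abs_secondDiff_newTerm_le_linear_of_shapes D τ R E Dom W hE0 hrec hτ hint hpos
    (fun g g' hg hg' => abs_action_sub_action_le_tower_unsubtracted D τ R E Dom W g g' hg hg' (fun U => hE0 _ _ U) hrec hτ hint hpos
      hP hEτ hR)
    (fun h hh k U hU t d hd htm ht htp => by
      have had : |t - (t - d)| = d := by rw [show t - (t - d) = d by ring, abs_of_pos hd]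
      exact abs_step_secondDiff_last (D k) (τ k) (R k) (E k h)
        (hint h k hh U hU _ htm) (hint h k hh U hU _ ht) (hint h k hh U hU _ htp) (hpos h k hh U hU _ ht)
        (fun B hB => by simpa only [had] using hP k U hU B hB (t - d) htm t ht)
        (fun B hB => by simpa only [had] using hEτ h k hh U hU B hB (t - d) htm t ht)
        (fun B hB => hP2 k U hU B hB t d hd htm ht htp) (fun B hB => hEτ2 h k hh U hU B hB t d hd htm ht htp)
        (hR2 k U hU t d hd htm ht htp))
    σ hg hik hd htm ht htp hU hσ

/-! ## §3 The tower with NEW-TERM-level letters -/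

/-- **THE SECOND-ORDER TOWER, NEW-TERM-LEVEL LETTERS.**  Per step, for every history of the window and every `U ∈ Dom (k+1)`: the
un-subtracted new term `a ↦ newTerm {D k with Q := 𝐄_k^h ∘ τ k} a U` is `L`-Lipschitz and has second differences `≤ λ₂·d²` between
couplings of the window, the remainder is `L_R`-Lipschitz with second differences `≤ M_R·d²` (the currency the Gaussian body supplies: the
twin's `hasDerivAt_newTerm_gaussian_of_quadDom`, `abs_secondDeriv_newTerm_gaussian_le` + the mean value theorem) ⟹
`|𝐄_k(g[i ↦ t+d]; U) − 2𝐄_k(g[i ↦ t]; U) + 𝐄_k(g[i ↦ t−d]; U)| ≤ (λ₂ + M_R + 2(L + L_R)²·(k − 1 − i))·d²` for every older coupling `i < k`.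
[cite: Balaban1987RG1, §0 (0.23) p.256, (2.11)–(2.13) pp.267–268, p.263 and §5 p.298] -/
theorem abs_secondDiff_action_le_linear_of_lip (D : ℕ → FluctData Y) (τ : (k : ℕ) → ℝ → Y → (D k).𝓑 → Y)
    (R : ℕ → ℝ → Y → ℝ) (E : ℕ → (ℕ → ℝ) → Y → ℝ) (Dom : ℕ → Set Y) (W : Set ℝ) {L LR lam₂ MR : ℝ}
    (hE0 : ∀ h h' : ℕ → ℝ, ∀ U, E 0 h U = E 0 h' U)
    (hrec : ∀ (h : ℕ → ℝ) (k : ℕ) (U : Y), (∀ i, h i ∈ W) →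
      E (k + 1) h U = FluctData.newTerm { D k with Q := fun a U B => E k h (τ k a U B) } (h k) U + R k (h k) U)
    (hτ : ∀ k U, U ∈ Dom (k + 1) → ∀ a ∈ W, ∀ B, (D k).χ U B ≠ 0 → τ k a U B ∈ Dom k)
    (hint : ∀ (h : ℕ → ℝ) (k : ℕ), (∀ i, h i ∈ W) → ∀ U ∈ Dom (k + 1), ∀ a ∈ W,
      Integrable (FluctData.integrand { D k with Q := fun a U B => E k h (τ k a U B) } a U) ((D k).μ U))
    (hpos : ∀ (h : ℕ → ℝ) (k : ℕ), (∀ i, h i ∈ W) → ∀ U ∈ Dom (k + 1), ∀ a ∈ W,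
      0 < FluctData.integral { D k with Q := fun a U B => E k h (τ k a U B) } a U)
    (hN : ∀ (h : ℕ → ℝ) (k : ℕ), (∀ i, h i ∈ W) → ∀ U ∈ Dom (k + 1), ∀ a ∈ W, ∀ a' ∈ W,
      |FluctData.newTerm { D k with Q := fun a U B => E k h (τ k a U B) } a' U -
        FluctData.newTerm { D k with Q := fun a U B => E k h (τ k a U B) } a U| ≤ L * |a' - a|)
    (hR : ∀ k, ∀ U ∈ Dom (k + 1), ∀ a ∈ W, ∀ a' ∈ W, |R k a' U - R k a U| ≤ LR * |a' - a|)
    (hN2 : ∀ (h : ℕ → ℝ) (k : ℕ), (∀ i, h i ∈ W) → ∀ U ∈ Dom (k + 1), ∀ t d : ℝ, 0 < d → t - d ∈ W → t ∈ W → t + d ∈ W →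
      |FluctData.newTerm { D k with Q := fun a U B => E k h (τ k a U B) } (t + d) U
        - 2 * FluctData.newTerm { D k with Q := fun a U B => E k h (τ k a U B) } t U
        + FluctData.newTerm { D k with Q := fun a U B => E k h (τ k a U B) } (t - d) U| ≤ lam₂ * d ^ 2)
    (hR2 : ∀ k, ∀ U ∈ Dom (k + 1), ∀ t d : ℝ, 0 < d → t - d ∈ W → t ∈ W → t + d ∈ W →
      |R k (t + d) U - 2 * R k t U + R k (t - d) U| ≤ MR * d ^ 2) :
    ∀ g : ℕ → ℝ, (∀ j, g j ∈ W) → ∀ (i k : ℕ), i < k → ∀ t d : ℝ, 0 < d → t - d ∈ W → t ∈ W → t + d ∈ W →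
      ∀ U ∈ Dom k,
        |E k (Function.update g i (t + d)) U - 2 * E k (Function.update g i t) U + E k (Function.update g i (t - d)) U|
          ≤ (lam₂ + MR + 2 * (L + LR) ^ 2 * ((k - 1 - i : ℕ) : ℝ)) * d ^ 2 :=
  abs_secondDiff_action_le_linear_of_shapes D τ R E Dom W hE0 hrec hτ hint hpos
    (fun g g' hg hg' => abs_action_sub_action_le_tower_of_lip D τ R E Dom W g g' hg hg' (fun U => hE0 _ _ U) hrec hτ hint hpos hN hR)
    (fun h hh k U hU t d hd htm ht htp => by
      rw [show (FluctData.newTerm { D k with Q := fun a U B => E k h (τ k a U B) } (t + d) U + R k (t + d) U)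
          - 2 * (FluctData.newTerm { D k with Q := fun a U B => E k h (τ k a U B) } t U + R k t U)
          + (FluctData.newTerm { D k with Q := fun a U B => E k h (τ k a U B) } (t - d) U + R k (t - d) U)
          = (FluctData.newTerm { D k with Q := fun a U B => E k h (τ k a U B) } (t + d) U
              - 2 * FluctData.newTerm { D k with Q := fun a U B => E k h (τ k a U B) } t U
              + FluctData.newTerm { D k with Q := fun a U B => E k h (τ k a U B) } (t - d) U)
            + (R k (t + d) U - 2 * R k t U + R k (t - d) U) by ring]
      calc _ ≤ |FluctData.newTerm { D k with Q := fun a U B => E k h (τ k a U B) } (t + d) U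
              - 2 * FluctData.newTerm { D k with Q := fun a U B => E k h (τ k a U B) } t U
              + FluctData.newTerm { D k with Q := fun a U B => E k h (τ k a U B) } (t - d) U|
            + |R k (t + d) U - 2 * R k t U + R k (t - d) U| := abs_add_le _ _
        _ ≤ lam₂ * d ^ 2 + MR * d ^ 2 := add_le_add (hN2 h k hh U hU t d hd htm ht htp) (hR2 k U hU t d hd htm ht htp)
        _ = (lam₂ + MR) * d ^ 2 := by ring)

/-- **THE SUBTRACTED NEW TERM, NEW-TERM-LEVEL LETTERS**: under §3's hypotheses, for `i < k`, a triple in the window, `U ∈ Dom (k+1)` and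
`σ U ∈ Dom k`, the subtracted new term of (2.13) has second difference in `g_i` at most `2·(λ₂ + M_R + 2(L + L_R)²·(k − i))·d²`.
[cite: Balaban1987RG1, (2.12)–(2.13) p.268 and §0 (0.23) p.256] -/
theorem abs_secondDiff_newTerm_le_linear_of_lip (D : ℕ → FluctData Y) (τ : (k : ℕ) → ℝ → Y → (D k).𝓑 → Y)
    (R : ℕ → ℝ → Y → ℝ) (E : ℕ → (ℕ → ℝ) → Y → ℝ) (Dom : ℕ → Set Y) (W : Set ℝ) {L LR lam₂ MR : ℝ}
    (hE0 : ∀ h h' : ℕ → ℝ, ∀ U, E 0 h U = E 0 h' U)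
    (hrec : ∀ (h : ℕ → ℝ) (k : ℕ) (U : Y), (∀ i, h i ∈ W) →
      E (k + 1) h U = FluctData.newTerm { D k with Q := fun a U B => E k h (τ k a U B) } (h k) U + R k (h k) U)
    (hτ : ∀ k U, U ∈ Dom (k + 1) → ∀ a ∈ W, ∀ B, (D k).χ U B ≠ 0 → τ k a U B ∈ Dom k)
    (hint : ∀ (h : ℕ → ℝ) (k : ℕ), (∀ i, h i ∈ W) → ∀ U ∈ Dom (k + 1), ∀ a ∈ W,
      Integrable (FluctData.integrand { D k with Q := fun a U B => E k h (τ k a U B) } a U) ((D k).μ U))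
    (hpos : ∀ (h : ℕ → ℝ) (k : ℕ), (∀ i, h i ∈ W) → ∀ U ∈ Dom (k + 1), ∀ a ∈ W,
      0 < FluctData.integral { D k with Q := fun a U B => E k h (τ k a U B) } a U)
    (hN : ∀ (h : ℕ → ℝ) (k : ℕ), (∀ i, h i ∈ W) → ∀ U ∈ Dom (k + 1), ∀ a ∈ W, ∀ a' ∈ W,
      |FluctData.newTerm { D k with Q := fun a U B => E k h (τ k a U B) } a' U -
        FluctData.newTerm { D k with Q := fun a U B => E k h (τ k a U B) } a U| ≤ L * |a' - a|)
    (hR : ∀ k, ∀ U ∈ Dom (k + 1), ∀ a ∈ W, ∀ a' ∈ W, |R k a' U - R k a U| ≤ LR * |a' - a|)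
    (hN2 : ∀ (h : ℕ → ℝ) (k : ℕ), (∀ i, h i ∈ W) → ∀ U ∈ Dom (k + 1), ∀ t d : ℝ, 0 < d → t - d ∈ W → t ∈ W → t + d ∈ W →
      |FluctData.newTerm { D k with Q := fun a U B => E k h (τ k a U B) } (t + d) U
        - 2 * FluctData.newTerm { D k with Q := fun a U B => E k h (τ k a U B) } t U
        + FluctData.newTerm { D k with Q := fun a U B => E k h (τ k a U B) } (t - d) U| ≤ lam₂ * d ^ 2)
    (hR2 : ∀ k, ∀ U ∈ Dom (k + 1), ∀ t d : ℝ, 0 < d → t - d ∈ W → t ∈ W → t + d ∈ W →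
      |R k (t + d) U - 2 * R k t U + R k (t - d) U| ≤ MR * d ^ 2)
    (σ : Y → Y) {g : ℕ → ℝ} (hg : ∀ j, g j ∈ W) {i k : ℕ} (hik : i < k) {t d : ℝ} (hd : 0 < d)
    (htm : t - d ∈ W) (ht : t ∈ W) (htp : t + d ∈ W) {U : Y} (hU : U ∈ Dom (k + 1)) (hσ : σ U ∈ Dom k) :
    |FluctData.newTerm
          { D k with Q := fun a U B => E k (Function.update g i (t + d)) (τ k a U B) - E k (Function.update g i (t + d)) (σ U) }
          (g k) U
      - 2 * FluctData.newTerm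
          { D k with Q := fun a U B => E k (Function.update g i t) (τ k a U B) - E k (Function.update g i t) (σ U) } (g k) U
      + FluctData.newTerm
          { D k with Q := fun a U B => E k (Function.update g i (t - d)) (τ k a U B) - E k (Function.update g i (t - d)) (σ U) }
          (g k) U|
      ≤ 2 * (lam₂ + MR + 2 * (L + LR) ^ 2 * ((k - i : ℕ) : ℝ)) * d ^ 2 :=
  abs_secondDiff_newTerm_le_linear_of_shapes D τ R E Dom W hE0 hrec hτ hint hpos
    (fun g g' hg hg' => abs_action_sub_action_le_tower_of_lip D τ R E Dom W g g' hg hg' (fun U => hE0 _ _ U) hrec hτ hint hpos hN hR)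
    (fun h hh k U hU t d hd htm ht htp => by
      rw [show (FluctData.newTerm { D k with Q := fun a U B => E k h (τ k a U B) } (t + d) U + R k (t + d) U)
          - 2 * (FluctData.newTerm { D k with Q := fun a U B => E k h (τ k a U B) } t U + R k t U)
          + (FluctData.newTerm { D k with Q := fun a U B => E k h (τ k a U B) } (t - d) U + R k (t - d) U)
          = (FluctData.newTerm { D k with Q := fun a U B => E k h (τ k a U B) } (t + d) U
              - 2 * FluctData.newTerm { D k with Q := fun a U B => E k h (τ k a U B) } t U
              + FluctData.newTerm { D k with Q := fun a U B => E k h (τ k a U B) } (t - d) U)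
            + (R k (t + d) U - 2 * R k t U + R k (t - d) U) by ring]
      calc _ ≤ |FluctData.newTerm { D k with Q := fun a U B => E k h (τ k a U B) } (t + d) U
              - 2 * FluctData.newTerm { D k with Q := fun a U B => E k h (τ k a U B) } t U
              + FluctData.newTerm { D k with Q := fun a U B => E k h (τ k a U B) } (t - d) U|
            + |R k (t + d) U - 2 * R k t U + R k (t - d) U| := abs_add_le _ _
        _ ≤ lam₂ * d ^ 2 + MR * d ^ 2 := add_le_add (hN2 h k hh U hU t d hd htm ht htp) (hR2 k U hU t d hd htm ht htp)
        _ = (lam₂ + MR) * d ^ 2 := by ring)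
    σ hg hik hd htm ht htp hU hσ

end Body

end Summit.QuantumFields.YangMills.BalabanUVNodes.N22KnitBodyTowerLetters

end
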